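import Literature.NumberTheory.LFunctions.RudnickSarnakNCellLimit
import Literature.NumberTheory.LFunctions.RudnickSarnakNCluster
import HarnessLib

/-!
# Rudnick–Sarnak `n`-level correlations for `ζ`: the limit of the windowed sums

Sibling file of `Literature/NumberTheory/LFunctions/RudnickSarnak.lean` (toward
`Literature.NumberTheory.LFunctions.rudnick_sarnak_unrestricted`, Rudnick–Sarnak 1996, Theorem 3.2
for `ζ`, at every level). Assembly of the front end (files IX–XVII of the `RudnickSarnakN` series)
into the smoothed asymptotic (Rudnick–Sarnak 1996, Thm. 3.1 in the `t`-windowed form; RH): for an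
admissible `Φ` at level `n = k + 1`,

  `W_Φ(T) / (T log T) → c_n · Λ(Φ)`,   `Λ(Φ) = Σ_D Σ_{P ⊆ Dᶜ} Σ_{β : P ≃ Dᶜ∖P} I_β(Φ)`

(`RudnickSarnakN.Unsmooth.tendsto_zeroSideSum_div_mul_log`), where `W_Φ = RudnickSarnakN.zeroSideSum Φ`,
`c_n = levelConst n` and `I_β = RudnickSarnakN.pairInt`: `W_Φ(T) = ∫ Φ V_T`
(`RudnickSarnakNSliceSum`, `RudnickSarnakNSlotDecomp`), `V_T = 𝔓_T + O(L^c T^{1−δ/2})`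
(`RudnickSarnakNPatterns`), `∫ Φ 𝔓_T = mainSum + O(T)` (`RudnickSarnakNMainTerm`) and the limit of
each cell (`RudnickSarnakNCellLimit`). The identification of `Λ(Φ)` with `∫ Φ C_O` (3.9) is the
remaining combinatorial step of the front end.

## References

* Z. Rudnick, P. Sarnak, *Zeros of principal `L`-functions and random matrix theory*, Duke Math.
  J. 81 (1996), 269–322, Thm. 3.1, (3.65)–(3.74).
-/

noncomputable section

open Complex Filter Set MeasureTheory Finset
open scoped Real Topology

namespace Literature.NumberTheory.LFunctions

namespace RudnickSarnakN

namespace Unsmooth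

variable {k : ℕ}

open scoped Classical in
/-- **The limit functional of the front end**: `Λ(Φ) = Σ_D Σ_{P ⊆ Dᶜ} Σ_{β : P ≃ Dᶜ∖P} I_β(Φ)`.
[cite: RudnickSarnak1996, (3.74)] -/
def frontLimit (k : ℕ) (Φ : (Fin (k + 1) → ℝ) → ℂ) : ℂ :=
  ∑ D ∈ (Finset.univ : Finset (Fin (k + 1))).powerset, ∑ P ∈ (Finset.univ \ D).powerset,
    ∑ β : (↥P ≃ ↥((Finset.univ \ D) \ P)), pairInt D P β Φ

/-- An admissible `Φ` is bounded. [folklore] -/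
theorem admissible_exists_bound {Φ : (Fin (k + 1) → ℝ) → ℂ} (h : IsRSAdmissiblePhi k Φ) :
    ∃ M : ℝ, ∀ ξ, ‖Φ ξ‖ ≤ M := by
  obtain ⟨M, hM⟩ := (h.contDiff.continuous.norm).bddAbove_range_of_hasCompactSupport h.hasCompactSupport.norm
  exact ⟨M, fun ξ ↦ hM (Set.mem_range_self ξ)⟩

/-- An admissible `Φ` is supported in the box `|ξ_j| ≤ 2`. [folklore] -/
theorem admissible_box {Φ : (Fin (k + 1) → ℝ) → ℂ} (h : IsRSAdmissiblePhi k Φ)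
    (ξ : Fin (k + 1) → ℝ) (hξ : Φ ξ ≠ 0) (j : Fin (k + 1)) : |ξ j| ≤ 2 := by
  by_contra hlt
  rw [not_le] at hlt
  have : 2 ≤ ‖ξ‖ := le_trans hlt.le (by rw [← Real.norm_eq_abs]; exact norm_le_pi_norm ξ j)
  exact hξ (h.eq_zero_of_le_norm this)

/-- An admissible `Φ` has a support margin on the slice: `Φ(ξ(η)) ≠ 0 ⟹ Σ_j |ξ_j(η)| ≤ 2 − δ`. [folklore] -/
theorem admissible_exists_margin {Φ : (Fin (k + 1) → ℝ) → ℂ} (h : IsRSAdmissiblePhi k Φ) :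
    ∃ δ : ℝ, 0 < δ ∧ ∀ η : Fin k → ℝ, Φ (slicePt η) ≠ 0 → ∑ j, |slicePt η j| ≤ 2 - δ := by
  obtain ⟨δ, hδ, hΦ⟩ := h.support_subset
  refine ⟨δ, hδ, fun η hne ↦ ?_⟩
  by_contra hlt
  exact hne (hΦ _ (not_le.1 hlt).le)

open scoped Classical in
/-- **The limit of the windowed sums** (Rudnick–Sarnak 1996, Thm. 3.1 in the `t`-windowed form of the
front end; RH): for an admissible `Φ` at level `n = k + 1`,
`W_Φ(T)/(T log T) → c_n · Λ(Φ)` with `c_n = (2π)⁻¹ ∫ κⁿ` and `Λ = frontLimit`.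
[cite: RudnickSarnak1996, Thm. 3.1, (3.65)–(3.74)] -/
theorem tendsto_zeroSideSum_div_mul_log (hRH : RiemannHypothesis) {Φ : (Fin (k + 1) → ℝ) → ℂ}
    (hΦ : IsRSAdmissiblePhi k Φ) :
    Tendsto (fun T : ℝ ↦ zeroSideSum Φ T / ((T : ℂ) * (Real.log T : ℂ))) atTop
      (𝓝 ((levelConst (k + 1) : ℂ) * frontLimit k Φ)) := by
  classical
  have hΦc : Continuous Φ := hΦ.contDiff.continuous
  obtain ⟨MΦ, hΦb⟩ := admissible_exists_bound hΦ
  have hΦs := admissible_box hΦ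
  obtain ⟨δ, hδ, hmargin⟩ := admissible_exists_margin hΦ
  have hΦi : Integrable fun η : Fin k → ℝ ↦ Φ (slicePt η) := integrable_phi_slicePt hΦc hΦb hΦs
  -- (1) the cells
  have hcells : Tendsto (fun T : ℝ ↦ mainSum Φ T / ((T : ℂ) * (Real.log T : ℂ))) atTop
      (𝓝 ((levelConst (k + 1) : ℂ) * frontLimit k Φ)) := by
    have h : Tendsto (fun T : ℝ ↦ ∑ D ∈ (Finset.univ : Finset (Fin (k + 1))).powerset,
        ∑ P ∈ (Finset.univ \ D).powerset, cellCoef T D * cellMain Φ T D P / ((T : ℂ) * (Real.log T : ℂ))) atTop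
        (𝓝 (∑ D ∈ (Finset.univ : Finset (Fin (k + 1))).powerset, ∑ P ∈ (Finset.univ \ D).powerset,
          (levelConst (k + 1) : ℂ) * ∑ β : (↥P ≃ ↥((Finset.univ \ D) \ P)), pairInt D P β Φ)) := by
      refine tendsto_finsetSum _ fun D _ ↦ tendsto_finsetSum _ fun P hP ↦ ?_
      exact tendsto_cellCoef_mul_cellMain_div (Finset.mem_powerset.1 hP) hΦc hΦb hΦs
    have e1 : (fun T : ℝ ↦ mainSum Φ T / ((T : ℂ) * (Real.log T : ℂ))) = fun T ↦
        ∑ D ∈ (Finset.univ : Finset (Fin (k + 1))).powerset, ∑ P ∈ (Finset.univ \ D).powerset,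
          cellCoef T D * cellMain Φ T D P / ((T : ℂ) * (Real.log T : ℂ)) := by
      funext T; unfold mainSum; rw [Finset.sum_div]; refine Finset.sum_congr rfl fun D _ ↦ ?_; rw [Finset.sum_div]
    have e2 : (levelConst (k + 1) : ℂ) * frontLimit k Φ = ∑ D ∈ (Finset.univ : Finset (Fin (k + 1))).powerset,
        ∑ P ∈ (Finset.univ \ D).powerset, (levelConst (k + 1) : ℂ) * ∑ β : (↥P ≃ ↥((Finset.univ \ D) \ P)), pairInt D P β Φ := by
      unfold frontLimit; rw [Finset.mul_sum]; refine Finset.sum_congr rfl fun D _ ↦ ?_; rw [Finset.mul_sum]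
    rw [e1, e2]; exact h
  -- (2) `W − mainSum = o(T L)`
  obtain ⟨C, hC0, hC⟩ := norm_slotIntegral_sub_patternSum_le hRH k hδ
  have herr : Tendsto (fun T : ℝ ↦ (zeroSideSum Φ T - mainSum Φ T) / ((T : ℂ) * (Real.log T : ℂ))) atTop (𝓝 0) := by
    set A : ℝ := ∫ η : Fin k → ℝ, ‖Φ (slicePt η)‖
    have hA : 0 ≤ A := integral_nonneg fun _ ↦ norm_nonneg _
    have hM0 : 0 ≤ MΦ := (norm_nonneg _).trans (hΦb 0)
    -- the bound, for `T ≥ 3`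
    have hbound : ∀ T : ℝ, 3 ≤ T → ‖zeroSideSum Φ T - mainSum Φ T‖ ≤
        C * (Real.log T + k + 5) ^ (3 * (k + 1) + 1) * T ^ (1 - δ / 2) * A + mainErrConst k * MΦ * T := by
      intro T hT
      have hT0 : (0 : ℝ) ≤ T := by linarith
      have hT2 : (2 : ℝ) ≤ T := by linarith
      have h1 := integrable_phi_mul_slotIntegral hΦi hT0
      have h2 := integrable_phi_mul_patternSum hΦi T
      have h3 : Integrable fun η : Fin k → ℝ ↦ Φ (slicePt η) * (slotIntegral T (slicePt η) - patternSum T (slicePt η)) := by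
        have := h1.sub h2; simp only [Pi.sub_def, ← mul_sub] at this; exact this
      rw [zeroSideSum_eq_integral_slotIntegral hΦi hT0]
      have e : (∫ η : Fin k → ℝ, Φ (slicePt η) * slotIntegral T (slicePt η)) - mainSum Φ T =
          (∫ η : Fin k → ℝ, Φ (slicePt η) * (slotIntegral T (slicePt η) - patternSum T (slicePt η))) +
          ((∫ η : Fin k → ℝ, Φ (slicePt η) * patternSum T (slicePt η)) - mainSum Φ T) := by
        rw [← sub_add_sub_cancel _ (∫ η : Fin k → ℝ, Φ (slicePt η) * patternSum T (slicePt η)), ← integral_sub h1 h2]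
        congr 2 with η; ring
      rw [e]
      refine (norm_add_le _ _).trans (add_le_add ?_ (norm_integral_patternSum_sub_mainSum_le hT hΦi hΦb hΦs))
      set E : ℝ := C * (Real.log T + k + 5) ^ (3 * (k + 1) + 1) * T ^ (1 - δ / 2)
      have hpt : ∀ η : Fin k → ℝ, ‖Φ (slicePt η) * (slotIntegral T (slicePt η) - patternSum T (slicePt η))‖ ≤ E * ‖Φ (slicePt η)‖ := by
        intro η
        by_cases h0 : Φ (slicePt η) = 0
        · simp [h0]
        · rw [norm_mul, mul_comm]
          exact mul_le_mul_of_nonneg_right (hC T hT2 (slicePt η) (fun j ↦ hΦs _ h0 j) (sum_slicePt η) (hmargin η h0)) (norm_nonneg _)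
      calc ‖∫ η : Fin k → ℝ, Φ (slicePt η) * (slotIntegral T (slicePt η) - patternSum T (slicePt η))‖
          ≤ ∫ η : Fin k → ℝ, E * ‖Φ (slicePt η)‖ := norm_integral_le_of_norm_le (hΦi.norm.const_mul E) (Eventually.of_forall hpt)
        _ = E * A := integral_const_mul _ _
    -- the bound is `o(T L)`
    rw [Metric.tendsto_atTop]
    intro ε hε
    -- `(L + k + 5)^p T^{1−δ/2} ≤ C_e T L · T^{-δ/2}`-type: we use `exists_errTerm_le`-style crude control:
    -- `(L+k+5)^p ≤ (k+6)^p L^p` and `L^p T^{1-δ/2} / (T L) = L^{p-1} T^{-δ/2} → 0`.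
    set p : ℕ := 3 * (k + 1) + 1
    have hlim1 : Tendsto (fun T : ℝ ↦ Real.log T ^ (p - 1) * T ^ (-(δ / 2))) atTop (𝓝 0) := by
      have h := (isLittleO_log_rpow_rpow_atTop (p - 1 : ℝ) (by positivity : 0 < δ / 2)).tendsto_div_nhds_zero
      refine h.congr' ?_
      filter_upwards [eventually_gt_atTop (0 : ℝ)] with T hT
      have hp1 : ((p : ℝ) - 1) = ((p - 1 : ℕ) : ℝ) := by rw [Nat.cast_sub (by omega)]; simp
      rw [hp1, Real.rpow_natCast, Real.rpow_neg hT.le, div_eq_mul_inv]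
    have hlim2 : Tendsto (fun T : ℝ ↦ mainErrConst k * MΦ / Real.log T) atTop (𝓝 0) :=
      tendsto_const_nhds.div_atTop Real.tendsto_log_atTop
    have hlim : Tendsto (fun T : ℝ ↦ C * ((k : ℝ) + 6) ^ p * A * (Real.log T ^ (p - 1) * T ^ (-(δ / 2))) +
        mainErrConst k * MΦ / Real.log T) atTop (𝓝 0) := by
      have := (hlim1.const_mul (C * ((k : ℝ) + 6) ^ p * A)).add hlim2
      rwa [mul_zero, zero_add] at this
    have hev := (tendsto_order.1 hlim).2 ε hε
    obtain ⟨T₀, hT₀⟩ := eventually_atTop.1 hev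
    refine ⟨max T₀ 3, fun T hT ↦ ?_⟩
    have hT0' : T₀ ≤ T := le_trans (le_max_left _ _) hT
    have hT3 : (3 : ℝ) ≤ T := le_trans (le_max_right _ _) hT
    have hTpos : 0 < T := by linarith
    have hL1 : 1 ≤ Real.log T := by
      rw [Real.le_log_iff_exp_le hTpos]
      exact le_trans (le_of_lt (lt_trans Real.exp_one_lt_d9 (by norm_num))) hT3
    have hL0 : 0 < Real.log T := by linarith
    have hTL : 0 < T * Real.log T := by positivity
    rw [dist_zero_right, norm_div, norm_mul, Complex.norm_real, Complex.norm_real, Real.norm_of_nonneg hTpos.le,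
      Real.norm_of_nonneg hL0.le, div_lt_iff₀ hTL]
    refine (hbound T hT3).trans_lt ?_
    have hkey := hT₀ T hT0'
    -- compare the bound with `(small) · T L`
    have h1 : (Real.log T + k + 5) ^ p ≤ ((k : ℝ) + 6) ^ p * Real.log T ^ p := by
      rw [← mul_pow]; exact pow_le_pow_left₀ (by positivity) (by nlinarith [Nat.cast_nonneg (α := ℝ) k]) _
    have h2 : Real.log T ^ p * T ^ (1 - δ / 2) = (Real.log T ^ (p - 1) * T ^ (-(δ / 2))) * (T * Real.log T) := by
      have hp : p = (p - 1) + 1 := by omega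
      conv_lhs => rw [hp, pow_succ]
      rw [show (1 : ℝ) - δ / 2 = -(δ / 2) + 1 by ring, Real.rpow_add hTpos, Real.rpow_one]
      ring
    have h3 : mainErrConst k * MΦ * T = (mainErrConst k * MΦ / Real.log T) * (T * Real.log T) := by
      field_simp
    calc C * (Real.log T + k + 5) ^ p * T ^ (1 - δ / 2) * A + mainErrConst k * MΦ * T
        ≤ C * (((k : ℝ) + 6) ^ p * Real.log T ^ p) * T ^ (1 - δ / 2) * A + mainErrConst k * MΦ * T := by
          gcongr
      _ = (C * ((k : ℝ) + 6) ^ p * A * (Real.log T ^ (p - 1) * T ^ (-(δ / 2))) + mainErrConst k * MΦ / Real.log T) *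
            (T * Real.log T) := by
          rw [h3, add_mul]; congr 1
          rw [show C * (((k : ℝ) + 6) ^ p * Real.log T ^ p) * T ^ (1 - δ / 2) * A =
            C * ((k : ℝ) + 6) ^ p * A * (Real.log T ^ p * T ^ (1 - δ / 2)) by ring, h2]; ring
      _ < ε * (T * Real.log T) := mul_lt_mul_of_pos_right hkey hTL
  -- (3) combine
  have := hcells.add herr
  rw [add_zero] at this
  refine this.congr' (Eventually.of_forall fun T ↦ ?_)
  simp only
  ring

end Unsmooth

end RudnickSarnakN

end Literature.NumberTheory.LFunctions

end
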